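import Summits.QuantumFields.YangMills.Theorems.LuscherReductionOneSiteLevelsKacCutoff
import Mathlib.Analysis.InnerProductSpace.PiL2

/-!
# Crux RED `RunningReduction`, line «KTR» PART 8 — stub `TT.stub_oneSiteTail`, tool 1:
# the min–max door for a finite-dimensional space of Kac functions (Gram–Schmidt + cut-off)

Support module for crux `RunningReduction` (route `LuscherReduction`, item stmt-QuantumFields-19978), registered stub
`TT.stub_oneSiteTail` (KTR PART 8, owner ym-beyond-p1; plan of record = STUB-READING of ym-cruxidea-19978-2 g10: S1 + S2′ + glue),
fleet base ym-luscher-20007-p1 (gen 4).  The B-uniform window count S2′ runs ONE's AbsUpper lane «in subspace mode» and ends with a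
finite-dimensional space of heat-smoothed flat functions whose energy form is bounded by `s` times the `L²` mass; this file is the
door turning that into `physLevel (n+1) ≤ s`:

* `energyBil_sum_mul_left` ∕ `energyBil_sum_mul_sum_mul` — finite bilinearity of the energy form on the admissible class `IsKacFn`;
* `physLevel_le_of_kacSubspace` — if an `(n+1)`-dimensional subspace `W ⊆ IsKacFn` (non-degenerate for `∫φ²`) has `𝔮(φ) ≤ s∫φ²` on `W`,
  then `physLevel (n+1) ≤ s`: Gram–Schmidt for the `L²` inner product on `W` (`stdOrthonormalBasis` of the `InnerProductSpace.Core`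
  `⟪φ,ψ⟫ = ∫φψ`, as in `Literature…finrank_le_of_pointwise_of_weight`), Green's identity `𝔮(u,v) = ∫ u·𝔥v` on the class
  (`energyBil_eq_integral_mul_hApply`), and the tree's cut-off door `physLevel_le_of_family`;
* `physLevel_le_of_kacFamily` — the same for the span of a finite family `u_0 … u_n` that is `L²`-non-degenerate
  (`a ≠ 0 ⇒ ∫(Σ a_i u_i)² > 0`).

HONEST FRAMING: elementary linear algebra over the tree's Kac-function class; femto rung R2b1 bookkeeping for the one-site (`L = 1`)
model only; nothing here is infinite volume, a mass gap or Clay.  Sorry-free, no new definitions, no named-fact hypotheses.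
-/

set_option autoImplicit false

noncomputable section

open MeasureTheory Filter Topology Real
open scoped BigOperators InnerProductSpace
open Literature.Analysis.OperatorTheory.YMMatrixModel

namespace Summit.QuantumFields.YangMills.Theorems.FemtoTransferGap.OST

open Summit.QuantumFields.YangMills.Theorems.FemtoTransferGap

/-! ### §1. Finite bilinearity of the energy form on the Kac class -/

/-- `𝔮(Σ_i c_i f_i, w) = Σ_i c_i 𝔮(f_i, w)` for Kac functions. [cite: ReedSimonIV1978, Thm. XIII.2] -/
theorem energyBil_sum_mul_left {ι : Type*} (s : Finset ι) (f : ι → ZM → ℝ) (hf : ∀ i, IsKacFn (f i)) (c : ι → ℝ)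
    {w : ZM → ℝ} (hw : IsKacFn w) :
    energyBil (fun x => ∑ i ∈ s, c i * f i x) w = ∑ i ∈ s, c i * energyBil (f i) w := by
  classical
  induction s using Finset.induction_on with
  | empty =>
    have e : (fun x : ZM => ∑ i ∈ (∅ : Finset ι), c i * f i x) = (0 : ℝ) • w := by
      funext x; simp
    rw [e, energyBil_smul_left, Finset.sum_empty, zero_mul]
  | insert a s ha ih =>
    have e : (fun x => ∑ i ∈ insert a s, c i * f i x) = (c a • f a) + fun x => ∑ i ∈ s, c i * f i x := by
      funext x; simp [Finset.sum_insert ha]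
    rw [e, energyBil_add_left ((hf a).smul (c a)) (isKacFn_sum_smul s f hf c) hw, energyBil_smul_left, ih,
      Finset.sum_insert ha]

/-- `𝔮(Σ_i a_i f_i, Σ_j b_j f_j) = Σ_i Σ_j a_i b_j 𝔮(f_i, f_j)` for Kac functions. [cite: ReedSimonIV1978, Thm. XIII.2] -/
theorem energyBil_sum_mul_sum_mul {ι : Type*} (s : Finset ι) (f : ι → ZM → ℝ) (hf : ∀ i, IsKacFn (f i)) (a b : ι → ℝ) :
    energyBil (fun x => ∑ i ∈ s, a i * f i x) (fun x => ∑ j ∈ s, b j * f j x) =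
      ∑ i ∈ s, ∑ j ∈ s, a i * b j * energyBil (f i) (f j) := by
  rw [energyBil_sum_mul_left s f hf a (isKacFn_sum_smul s f hf b)]
  refine Finset.sum_congr rfl fun i _ => ?_
  rw [energyBil_comm, energyBil_sum_mul_left s f hf b (hf i), Finset.mul_sum]
  refine Finset.sum_congr rfl fun j _ => ?_
  rw [energyBil_comm]; ring

/-! ### §2. The min–max door for a finite-dimensional Kac subspace -/

/-- **Min–max door, subspace form.**  If `W` is an `(n+1)`-dimensional space of Kac functions on which `∫φ² = 0 ⇒ φ = 0` and
`𝔮(φ) ≤ s ∫φ²` (`0 ≤ s`), then `physLevel (n+1) ≤ s`.  (Gram–Schmidt in the `L²` inner product on `W`, Green's identity on the class, and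
the cut-off door `physLevel_le_of_family`.) [cite: ReedSimonIV1978, Thm. XIII.1–2] -/
theorem physLevel_le_of_kacSubspace {n : ℕ} (W : Submodule ℝ (ZM → ℝ)) (hW : Module.finrank ℝ W = n + 1)
    (hkac : ∀ φ ∈ W, IsKacFn φ) (hdef : ∀ φ ∈ W, ∫ x, φ x ^ 2 = 0 → φ = 0) {s : ℝ} (hs0 : 0 ≤ s)
    (hs : ∀ φ ∈ W, energyForm φ ≤ s * ∫ x, φ x ^ 2) : physLevel (n + 1) ≤ s := by
  classical
  haveI : FiniteDimensional ℝ W := Module.finite_of_finrank_eq_succ hW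
  have hmul : ∀ φ ψ : W, Integrable fun x => (φ : ZM → ℝ) x * (ψ : ZM → ℝ) x := fun φ ψ =>
    (hkac _ φ.2).integrable_mul (hkac _ ψ.2)
  let core : InnerProductSpace.Core ℝ W :=
    { inner := fun φ ψ => ∫ x, (φ : ZM → ℝ) x * (ψ : ZM → ℝ) x
      conj_inner_symm := fun φ ψ => by
        simp only [conj_trivial]
        exact integral_congr_ae (Eventually.of_forall fun x => mul_comm _ _)
      re_inner_nonneg := fun φ => by
        simp only [RCLike.re_to_real]
        exact integral_nonneg fun x => mul_self_nonneg _
      add_left := fun φ ψ χ => by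
        simp only [Submodule.coe_add, Pi.add_apply, add_mul]
        exact integral_add (hmul φ χ) (hmul ψ χ)
      smul_left := fun φ ψ r => by
        simp only [Submodule.coe_smul, Pi.smul_apply, smul_eq_mul, conj_trivial, mul_assoc]
        exact integral_const_mul _ _
      definite := fun φ h => by
        have h' : ∫ x, (φ : ZM → ℝ) x ^ 2 = 0 := by
          simpa only [sq] using h
        exact Subtype.ext (hdef _ φ.2 h') }
  letI : NormedAddCommGroup W := @InnerProductSpace.Core.toNormedAddCommGroup ℝ W _ _ _ core
  letI : InnerProductSpace ℝ W := InnerProductSpace.ofCore _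
  have inner_eq : ∀ φ ψ : W, ⟪φ, ψ⟫_ℝ = ∫ x, (φ : ZM → ℝ) x * (ψ : ZM → ℝ) x := fun _ _ => rfl
  have norm_sq_eq : ∀ φ : W, ‖φ‖ ^ 2 = ∫ x, (φ : ZM → ℝ) x ^ 2 := fun φ => by
    rw [← real_inner_self_eq_norm_sq, inner_eq]
    simp only [sq]
  -- an orthonormal basis indexed by `Fin (n+1)`
  let b : OrthonormalBasis (Fin (n + 1)) ℝ W := (stdOrthonormalBasis ℝ W).reindex (finCongr hW)
  let g : Fin (n + 1) → ZM → ℝ := fun i => (b i : ZM → ℝ)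
  have hg : ∀ i, IsKacFn (g i) := fun i => hkac _ (b i).2
  have horth : ∀ i j, ∫ x, g i x * g j x = if i = j then (1 : ℝ) else 0 := fun i j => by
    rw [← inner_eq]
    exact orthonormal_iff_ite.1 b.orthonormal i j
  -- the energy matrix of the basis
  have hmat : ∀ a : Fin (n + 1) → ℝ,
      ∑ i, ∑ j, a i * a j * ∫ x, g i x * hApply (g j) x ≤ s * ∑ i, a i ^ 2 := by
    intro a
    let φ : W := ∑ i, a i • b i
    have hφ : (φ : ZM → ℝ) = fun x => ∑ i, a i * g i x := by
      funext x
      simp only [φ, Submodule.coe_sum, Submodule.coe_smul, Finset.sum_apply, Pi.smul_apply, smul_eq_mul, g]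
    have hnorm : ∫ x, (φ : ZM → ℝ) x ^ 2 = ∑ i, a i ^ 2 := by
      rw [← norm_sq_eq, ← real_inner_self_eq_norm_sq, b.orthonormal.inner_sum a a Finset.univ]
      simp [sq]
    have hexp : ∑ i, ∑ j, a i * a j * ∫ x, g i x * hApply (g j) x = energyForm (φ : ZM → ℝ) := by
      rw [← energyBil_self, hφ, energyBil_sum_mul_sum_mul Finset.univ g hg a a]
      refine Finset.sum_congr rfl fun i _ => Finset.sum_congr rfl fun j _ => ?_
      rw [energyBil_eq_integral_mul_hApply (hg i) (hg j)]
    rw [hexp, ← hnorm]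
    exact hs _ φ.2
  exact physLevel_le_of_family g hg horth hs0 hmat

/-! ### §3. Family form -/

/-- **Min–max door, family form.**  Let `u_0, …, u_n` be Kac functions whose span is `L²`-non-degenerate
(`a ≠ 0 ⇒ ∫ (Σ a_i u_i)² > 0`) and carries the Rayleigh bound `𝔮(Σ a_i u_i) ≤ s ∫(Σ a_i u_i)²` (`0 ≤ s`).  Then `physLevel (n+1) ≤ s`.
[cite: ReedSimonIV1978, Thm. XIII.1–2] -/
theorem physLevel_le_of_kacFamily {n : ℕ} (u : Fin (n + 1) → ZM → ℝ) (hu : ∀ i, IsKacFn (u i)) {s : ℝ} (hs0 : 0 ≤ s)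
    (hpos : ∀ a : Fin (n + 1) → ℝ, a ≠ 0 → 0 < ∫ x, (∑ i, a i * u i x) ^ 2)
    (hs : ∀ a : Fin (n + 1) → ℝ, energyForm (fun x => ∑ i, a i * u i x) ≤ s * ∫ x, (∑ i, a i * u i x) ^ 2) :
    physLevel (n + 1) ≤ s := by
  classical
  -- the span as the range of the coefficient map
  let T : (Fin (n + 1) → ℝ) →ₗ[ℝ] (ZM → ℝ) :=
    { toFun := fun a x => ∑ i, a i * u i x
      map_add' := fun a b => by
        funext x
        simp only [Pi.add_apply, add_mul, Finset.sum_add_distrib]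
      map_smul' := fun c a => by
        funext x
        simp only [Pi.smul_apply, smul_eq_mul, RingHom.id_apply, Finset.mul_sum, mul_assoc] }
  have hT : ∀ a, T a = fun x => ∑ i, a i * u i x := fun a => rfl
  have hinj : Function.Injective T := by
    intro a b hab
    by_contra hne
    have hne' : a - b ≠ 0 := sub_ne_zero.2 hne
    have h0 : T (a - b) = 0 := by rw [map_sub, hab, sub_self]
    have h1 := hpos (a - b) hne'
    have h2 : (fun x => ∑ i, (a - b) i * u i x) = 0 := by rw [← hT]; exact h0
    have h3 : ∫ x, (∑ i, (a - b) i * u i x) ^ 2 = 0 := by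
      have h2' := congr_fun h2
      simp only [Pi.zero_apply] at h2'
      have : (fun x => (∑ i, (a - b) i * u i x) ^ 2) = fun _ => 0 := by
        funext x; rw [h2' x]; ring
      rw [this, integral_zero]
    linarith
  have hfin : Module.finrank ℝ (LinearMap.range T) = n + 1 := by
    rw [LinearMap.finrank_range_of_inj hinj]; simp
  refine physLevel_le_of_kacSubspace (LinearMap.range T) hfin (fun φ hφ => ?_) (fun φ hφ h0 => ?_) hs0 (fun φ hφ => ?_)
  · obtain ⟨a, rfl⟩ := LinearMap.mem_range.1 hφ
    rw [hT]; exact isKacFn_sum_smul Finset.univ u hu a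
  · obtain ⟨a, rfl⟩ := LinearMap.mem_range.1 hφ
    by_contra hne
    have ha : a ≠ 0 := by
      intro ha; apply hne; rw [ha, map_zero]
    have h1 := hpos a ha
    rw [hT] at h0
    simp only at h0
    linarith
  · obtain ⟨a, rfl⟩ := LinearMap.mem_range.1 hφ
    rw [hT]; exact hs a

end Summit.QuantumFields.YangMills.Theorems.FemtoTransferGap.OST

end
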